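import Mathlib.Algebra.Order.Monoid.TypeTags
import Literature.IUT.HodgeArakelov.TemperedThetaMonoidsProofs
import Literature.AnabelianGeometry.EtaleTheta.LogDivisorModelTateTowerThetaGalois
import HarnessLib

/-!
# [IUTchII] Example 3.2 at a GENUINE Frobenioid-side datum: the theta monoids of the [EtTh] §3 `Ÿ`-skeleton
# with cusps and theta (abc-iut cell, layer L6; L-F register row LF6-01, F-2568; proof-only, no definitions)

S. Mochizuki, *Inter-universal Teichmüller theory II*, kurims manuscript (Dec. 2020), §3, Example 3.2 (i)–(ii),
pp. 88–89 [claim: Mochizuki2012, status: disputed] (IUTchII §3 Ex 3.2, kurims p.88): "`Ψ_{F^Θ_v,α} :=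
O^×_{C^Θ_v}(A^Θ_∞) · Θ^α_v|^ℕ_{A^Θ_∞}`, `∞Ψ_{F^Θ_v,α} := O^×_{C^Θ_v}(A^Θ_∞) · Θ^α_v|^{ℚ≥0}_{A^Θ_∞}` … one has a natural
surjection `Π_v ↠ Aut_{D_v}(Ÿ_v)`, as well as a natural conjugation action of `Π_v` on the collections of submonoids …
`Θ^{ℚ≥0}_v|_{A^Θ_∞}` determines characteristic splittings, up to torsion, of the monoids `Ψ_{F^Θ_v,α}` …, `∞Ψ_{F^Θ_v,α}`
which are compatible with the action of `Π_v`" (p.88 l.55–83, p.89 l.2–3, l.22–27); (ii) "we obtain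
a monoid [in the usual sense] `Ψ_{C_v} := O^▷_{C_v}(A^Θ_∞)` which is equipped with a natural action by `Π_v`" (p.89
l.59–65; v2 doc-only: this clause re-quoted verbatim — referee aud-12 OBS, v1 had paraphrased it as a
"`(Π_v ↠) G_v`-action"). abc-iut-L6-t2 typed this as the structure
`Literature.IUT.HodgeArakelov.TemperedThetaMonoids.Example32Statements F` over the input record
`TemperedFrobenioidThetaData P = ⟨K, conj, units, theta, baseMonoid⟩` (`TemperedThetaMonoids.lean`, p404874); its
`∀`-closure over free input data is refuted (`not_forall_example32Statements`, p430842) — the instance forms are the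
content; the conditional closer of record is `example32Statements_of_val (hU) (hB) (v) (hv) (hθ)` (p405901) and the
only instance in the tree was the TOY shear witness `example32Statements_witness` (`ℤ ↷ ℚ × ℚ`, p406543).
L-F register row LF6-01 (plan/L6/LF-IUT.tsv v2.1): «GENUINE INSTANCE ABSENT».

THIS FILE supplies the genuine FROBENIOID-SIDE instance, at layer L2's combinatorial skeleton of the double Tate tower
`Ÿ` with its cusps and its theta function — abc-iut-L2-t3's `LogDivisorModel.TateTowerTheta.model` ([EtTh] Def. 3.1 /
Prop. 3.2 inhabitant: functions `Fn = μ₂ × ⟨ϖ̈⟩ × ⟨Ü⟩ × ⟨Θ̈⟩`, `divisor((−1)^ε ϖ̈^c Ü^k Θ̈^t) = (F_j ↦ c + k·j − t·j², cusp ↦ t)`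
read off [EtTh] Prop. 1.4 (i)) with its Galois action `TateTowerTheta.action φ` for an ARBITRARY group `G` acting
through a character `φ : G → ℤ = Gal(Ÿ/X)` (print: `Π_v` acts through `Π_v ↠ Aut_{D_v}(Ÿ_v)`; translation of the
chain with the shear of the functional equation [EtTh] Prop. 1.4 (ii) `Θ̈(q^{a/2}Ü) = (−1)^a q^{−a²/2} Ü^{−2a} Θ̈(Ü)`,
`TateTowerTheta.actFn_theta`). The Example 3.2 input record is, with NO new definition (inline constructor):
* `K := Fn` — "`O^×(T^÷_{A^Θ_∞})`": every non-zero meromorphic function is a unit of the birationalization;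
* `conj := (TateTowerTheta.action φ).actFn` — the `Π_v`-action of record;
* `units := ker(divisor) = TateTowerTheta.divHom.ker` — "`O^×_{C^Θ_v}(A^Θ_∞)`", the functions with trivial log-divisor;
* `theta := TateTowerTheta.theta = Θ̈`;
* `baseMonoid := TateTowerTheta.intConstants = O^▷ = μ₂ × ϖ̈^ℕ` — "`Ψ_{C_v} = O^▷_{C_v}(A^Θ_∞)`" («`O^× · q^ℕ`», `ϖ̈ = q_X^{1/2}`).
Then **`example32Statements_tateTowerTheta`**: `Example32Statements` HOLDS at this datum for EVERY `G`, `φ`, by the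
closer of record `example32Statements_of_val` with ALL FIVE binders DISCHARGED — `hU`: trivial-divisor functions
are constants, fixed by the action (`TateTowerTheta.actFn_of_mem_const`); `hB`: the action law `act_mem_intConst` of
the `GaloisAction` record; `v` := print's "order of the divisor" ([IUTchI] Ex. 3.2 (v)) AT A CUSP (the `Θ̈`-exponent
`t`, `divFun_inl`), valued in the ordered group `ℤ`; `hv`: trivial on `ker(divisor)`; `hθ`: `ord_cusp(Θ̈) = 1 > 0`
(simple zeros of `Θ̈` at the cusps, [EtTh] Prop. 1.4 (i)). Residual binders BY NAME: NONE.
NON-DEGENERACY (§2): `Θ̈` is not torsion, is MOVED by every `g` with `φ g ≠ 1` and fixed exactly when `φ g = 1`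
(so the collection `{Ψ_{F^Θ,α}}_α` is GENUINELY permuted, through `G ↠ φ(G) ⊆ ℤ`), `Θ̈ ∉ Ψ_{C_v}`, `Θ̈ ∉ O^×`.
HONEST WORDS: an instance-form theorem at OUR combinatorial skeleton (NOT the formal scheme `Ÿ`; no constant field):
there `O^×_{C^Θ_v} = μ₂` is torsion (`isOfFinOrder_of_mem_units`, disclosed), so clause (i) «splitting up to
torsion» would also hold a fortiori — the proof GIVEN is print's divisor-order route, the content that transfers to a
`Θ̈`-carrying tower over a genuine constant field (`O^× = O_L^×`), which the tree does not yet hold (the ARITHMETIC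
Tate tower has `L^×` but no `Θ̈`; the theta-twist / Kummer towers have roots of `Θ̈` but constants = roots of unity).
No side taken on [IUTchIII] Cor. 3.12; typed ≠ proved; an instance at OUR model is not the print universal closure;
nothing here asserts abc proved or refuted. [claim: Mochizuki2012, status: disputed] for the IUT sentences quoted;
the mathematics is exponent bookkeeping on `μ₂ × ℤ³` ([EtTh] Prop. 1.4, refereed) [cite: MochizukiEtTh2009, Prop 1.4 p.21].
-/

namespace Literature.IUT.HodgeArakelov

namespace TemperedThetaMonoids

open Literature.AnabelianGeometry.EtaleTheta
open Literature.AnabelianGeometry.EtaleTheta.LogDivisorModel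
open Literature.AnabelianGeometry.EtaleTheta.LogDivisorModel.TateTowerTheta
open Multiplicative

variable {G : Type} [Group G] (φ : G →* Multiplicative ℤ)

/-! ### 1. The units `O^×_{C^Θ_v}(A^Θ_∞) = ker(divisor)` of the skeleton -/

/-- The functions of the `Ÿ`-skeleton with trivial log-divisor are exactly `μ₂` (`c = k = t = 0`): "units of `O_L` have
trivial divisor" ([EtTh] Prop. 3.2 (ii)) and the skeleton has no constant field beyond `μ₂ × ⟨ϖ̈⟩`.
[cite: MochizukiEtTh2009, Prop 3.2 p.70] -/
theorem mem_ker_divHom_iff (f : Multiplicative Exp) :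
    f ∈ divHom.ker ↔ eC (toAdd f) = 0 ∧ eU (toAdd f) = 0 ∧ eT (toAdd f) = 0 := by
  rw [MonoidHom.mem_ker]
  constructor
  · intro h
    have h' : ∀ x, divFun (toAdd f) x = 0 := fun x => by
      have e := congrArg (fun d : Multiplicative (Idx → ℤ) => toAdd d x) h
      rw [toAdd_divHom, toAdd_one, Pi.zero_apply] at e
      exact e
    have ht : eT (toAdd f) = 0 := by simpa using h' (Sum.inl (0, false))
    have hc : eC (toAdd f) = 0 := by simpa [ht] using h' (Sum.inr 0)
    have hk : eU (toAdd f) = 0 := by simpa [ht, hc] using h' (Sum.inr 1)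
    exact ⟨hc, hk, ht⟩
  · rintro ⟨hc, hk, ht⟩
    refine toAdd.injective (funext fun x => ?_)
    rw [toAdd_divHom, toAdd_one, Pi.zero_apply]
    rcases x with c | j
    · rw [divFun_inl, ht]
    · rw [divFun_inr, hc, hk, ht]; ring

/-- The units are constants (`μ₂ ⊆ μ₂ × ⟨ϖ̈⟩ = model.const`). [cite: MochizukiEtTh2009, Def 3.1 p.70] -/
theorem mem_const_of_mem_ker_divHom {f : Multiplicative Exp} (hf : f ∈ divHom.ker) :
    f ∈ TateTowerTheta.model.const :=
  ⟨((mem_ker_divHom_iff f).1 hf).2.1, ((mem_ker_divHom_iff f).1 hf).2.2⟩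

/-- HONEST DISCLOSURE: at the skeleton every unit is TORSION (`O^× = μ₂`: `f = (ε, 0, 0, 0)`, `f² = 1`), so the
«splitting up to torsion» clause of Example 3.2 (i) also holds a fortiori here; the proof below nevertheless runs
print's divisor-order route. [cite: MochizukiEtTh2009, Prop 3.2 p.70] -/
theorem isOfFinOrder_of_mem_units {f : Multiplicative Exp} (hf : f ∈ divHom.ker) : IsOfFinOrder f := by
  obtain ⟨hc, hk, ht⟩ := (mem_ker_divHom_iff f).1 hf
  refine isOfFinOrder_iff_pow_eq_one.2 ⟨2, two_pos, toAdd.injective ?_⟩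
  rw [toAdd_pow, toAdd_one, two_nsmul]
  refine ext_exp ?_ ?_ ?_ ?_
  · change (toAdd f).1 + (toAdd f).1 = (0 : ZMod 2)
    rw [← two_mul, show (2 : ZMod 2) = 0 from rfl, zero_mul]
  · change eC (toAdd f + toAdd f) = (0 : ℤ)
    rw [eC_add, hc, add_zero]
  · change eU (toAdd f + toAdd f) = (0 : ℤ)
    rw [eU_add, hk, add_zero]
  · change eT (toAdd f + toAdd f) = (0 : ℤ)
    rw [eT_add, ht, add_zero]

/-! ### 2. The order of the divisor at a cusp -/

/-- **"The order of the divisor" at a cusp** ([IUTchI] Ex. 3.2 (v); here the `Θ̈`-exponent `t = ord_{cusp}`, [EtTh] Prop. 1.4 (i))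
as a homomorphism `Fn → ℤ` to the ORDERED group `ℤ`: it kills `O^× = ker(divisor)` and is `> 1` (i.e. `> 0` additively)
on `Θ̈` — exactly the inputs `(v, hv, hθ)` of the closer of record `example32Statements_of_val`. Existential (no
definition is introduced): the witness is the `Θ̈`-exponent projection, and its value at `f` IS the multiplicity of
`divisor f` at any cusp `c`. [cite: MochizukiEtTh2009, Prop 1.4 p.21] -/
theorem exists_cuspOrder :
    ∃ v : Multiplicative Exp →* Multiplicative ℤ,
      (∀ (f : Multiplicative Exp) (c : Cusp),
        v f = ofAdd (toAdd (TateTowerTheta.model.divisor ⟨f, Subgroup.mem_top f⟩) (Sum.inl c))) ∧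
      (∀ u ∈ divHom.ker, v u = 1) ∧ 1 < v TateTowerTheta.theta := by
  let πT : Exp →+ ℤ :=
    (AddMonoidHom.snd ℤ ℤ).comp ((AddMonoidHom.snd ℤ (ℤ × ℤ)).comp (AddMonoidHom.snd (ZMod 2) (ℤ × ℤ × ℤ)))
  refine ⟨AddMonoidHom.toMultiplicative πT, fun f c => rfl, fun u hu => ?_, ?_⟩
  · obtain ⟨-, -, ht⟩ := (mem_ker_divHom_iff u).1 hu
    exact toAdd.injective ht
  · change ofAdd (0 : ℤ) < ofAdd (1 : ℤ)
    rw [ofAdd_lt]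
    exact zero_lt_one

/-! ### 3. Example 3.2 at the `Ÿ`-skeleton -/

/-- **F-2568 / IUTchII:Ex3.2 HOLDS AT THE GENUINE `Ÿ`-SKELETON** — for every group `G` acting through a character
`φ : G → ℤ = Gal(Ÿ/X)`: the Example 3.2 statements (characteristic splittings up to torsion of every `∞Ψ_{F^Θ,α}`,
hence of every `Ψ_{F^Θ,α}`, compatible with the action; `Π_v`-stability of `O^×_{C^Θ_v}` and of `Ψ_{C_v}`) for the
input record `⟨Fn, (action φ).actFn, ker(divisor), Θ̈, O^▷⟩` of abc-iut-L2-t3's `TateTowerTheta.model` with its Galois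
action of record — by the closer of record `example32Statements_of_val`, binders `hU hB v hv hθ` ALL DISCHARGED
(constants are fixed by the action; `act_mem_intConst`; order at a cusp; simple zeros of `Θ̈` at the cusps).
Residual binders BY NAME: none. [claim: Mochizuki2012, status: disputed] (IUTchII §3 Ex 3.2 (i)(ii), kurims pp.88–89)
[cite: MochizukiEtTh2009, Prop 1.4 p.21] -/
theorem example32Statements_tateTowerTheta :
    Example32Statements
      (⟨CommGrpCat.of (Multiplicative Exp), (TateTowerTheta.action φ).actFn, divHom.ker, TateTowerTheta.theta,
        intConstants⟩ : TemperedFrobenioidThetaData.{0, 0} G) := by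
  obtain ⟨v, -, hv, hθ⟩ := exists_cuspOrder
  refine example32Statements_of_val _ (Γ := Multiplicative ℤ) ?_ ?_ v hv hθ
  · -- `O^×` is `Π_v`-stable: units are constants, and constants are FIXED by the action
    intro g x hx
    change (TateTowerTheta.action φ).actFn g x ∈ divHom.ker
    rw [actFn_of_mem_const φ g (mem_const_of_mem_ker_divHom hx)]
    exact hx
  · -- `Ψ_{C_v} = O^▷` is `Π_v`-stable: the `act_mem_intConst` law of the Galois action of record
    intro g x hx
    exact (TateTowerTheta.action φ).act_mem_intConst g hx

/-- The same at the deck group `Gal(Ÿ/X) = ℤ` itself (`φ = id`). [claim: Mochizuki2012, status: disputed]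
(IUTchII §3 Ex 3.2, kurims p.88) [cite: MochizukiEtTh2009, Def 3.3 p.73] -/
theorem example32Statements_tateTowerTheta_deck :
    Example32Statements
      (⟨CommGrpCat.of (Multiplicative Exp), (TateTowerTheta.action (MonoidHom.id (Multiplicative ℤ))).actFn,
        divHom.ker, TateTowerTheta.theta, intConstants⟩ : TemperedFrobenioidThetaData.{0, 0} (Multiplicative ℤ)) :=
  example32Statements_tateTowerTheta (MonoidHom.id (Multiplicative ℤ))

/-- The splitting clause of Example 3.2 (i) at `α`, unfolded at the skeleton: `O^× ∩ (Θ̈^α)^{ℚ≥0}` is torsion, where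
`Θ̈^α = (−1)^a ϖ̈^{−a²} Ü^{2a} Θ̈`, `a = φ α`. [claim: Mochizuki2012, status: disputed] (IUTchII §3 Ex 3.2 (i), kurims p.89)
[cite: MochizukiEtTh2009, Prop 1.4 p.22] -/
theorem splitting_tateTowerTheta (α : G) :
    IsSplittingUpToTorsion divHom.ker (rootPowers ((TateTowerTheta.action φ).actFn α TateTowerTheta.theta)) :=
  (example32Statements_tateTowerTheta φ).splitting α

/-! ### 4. Non-degeneracy of the instance -/

/-- `Θ̈` is not a torsion function (its cusp order is `1`). [cite: MochizukiEtTh2009, Prop 1.4 p.21] -/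
theorem theta_not_isOfFinOrder : ¬ IsOfFinOrder TateTowerTheta.theta := by
  obtain ⟨v, -, -, hθ⟩ := exists_cuspOrder
  intro h
  have h2 := isOfFinOrder_iff_pow_eq_one.1 (v.isOfFinOrder h)
  obtain ⟨n, hn, hvn⟩ := h2
  have hle : (1 : Multiplicative ℤ) < v TateTowerTheta.theta ^ n := one_lt_pow' hθ hn.ne'
  exact (lt_irrefl _) (hvn ▸ hle)

/-- `Θ̈` is not a unit (`Θ̈ ∉ O^×_{C^Θ_v}`): its divisor is non-trivial. [cite: MochizukiEtTh2009, Prop 1.4 p.21] -/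
theorem theta_not_mem_ker_divHom : TateTowerTheta.theta ∉ divHom.ker := fun h => by
  have ht := ((mem_ker_divHom_iff _).1 h).2.2
  change eT ((0, 0, 0, 1) : Exp) = 0 at ht
  exact one_ne_zero ht

/-- `Θ̈ ∉ Ψ_{C_v} = O^▷` (it is not a constant: it has poles along the chain and zeros at the cusps).
[cite: MochizukiEtTh2009, Prop 1.4 p.21] -/
theorem theta_not_mem_intConstants : TateTowerTheta.theta ∉ intConstants := fun h => by
  have ht : eT ((0, 0, 0, 1) : Exp) = 0 := h.2.2
  exact one_ne_zero ht

/-- **The action MOVES `Θ̈` exactly when it moves the chain**: `Θ̈^g = Θ̈ ⟺ φ g = 1` (the functional equation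
[EtTh] Prop. 1.4 (ii): `Θ̈^g = (−1)^a ϖ̈^{−a²} Ü^{2a} Θ̈` with `a = φ g`; the `Ü`-exponent `2a` vanishes iff `a = 0`).
[cite: MochizukiEtTh2009, Prop 1.4 p.22] -/
theorem actFn_theta_eq_theta_iff (g : G) :
    (TateTowerTheta.action φ).actFn g TateTowerTheta.theta = TateTowerTheta.theta ↔ φ g = 1 := by
  constructor
  · intro h
    have e := congrArg (fun f : Multiplicative Exp => eU (toAdd f)) h
    change eU (toAdd ((TateTowerTheta.action φ).actFn g TateTowerTheta.theta)) = eU (toAdd TateTowerTheta.theta) at e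
    -- the `Ü`-exponent of `Θ̈^g` is `eU Θ̈ + 2·a·eT Θ̈ = 2a` ([EtTh] Prop. 1.4 (ii))
    have e' : eU (toAdd ((TateTowerTheta.action φ).actFn g TateTowerTheta.theta)) =
        eU (toAdd TateTowerTheta.theta) + 2 * toAdd (φ g) * eT (toAdd TateTowerTheta.theta) :=
      eU_shear _ _
    rw [e] at e'
    change (0 : ℤ) = 0 + 2 * toAdd (φ g) * 1 at e'
    have h0 : toAdd (φ g) = 0 := by omega
    rw [← ofAdd_toAdd (φ g), h0, ofAdd_zero]
  · intro h
    refine toAdd.injective ?_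
    rw [actFn_theta, h, toAdd_one]
    rfl

/-- Hence every `g` off the kernel of `φ` moves `Θ̈` — the collection `{Ψ_{F^Θ,α}}_α` of Example 3.2 (i) is GENUINELY
permuted by the "natural conjugation action of `Π_v`" (not a constant family). [claim: Mochizuki2012, status: disputed]
(IUTchII §3 Ex 3.2 (i), kurims p.89) [cite: MochizukiEtTh2009, Prop 1.4 p.22] -/
theorem actFn_theta_ne_theta {g : G} (hg : φ g ≠ 1) :
    (TateTowerTheta.action φ).actFn g TateTowerTheta.theta ≠ TateTowerTheta.theta :=
  fun h => hg ((actFn_theta_eq_theta_iff φ g).1 h)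

/-- The conjugates `Θ̈^α`, `Θ̈^β` coincide iff `φ α = φ β`: the conjugates of `Θ̈` form a TORSOR under the deck group
`φ(G) ⊆ ℤ = Gal(Ÿ/X)` (print: the `l·ℤ`-torsor of the `Θ^α_v`, at the `X̲`-level). [claim: Mochizuki2012, status: disputed]
(IUTchII §3 Ex 3.2 (i), kurims p.89) [cite: MochizukiEtTh2009, Prop 1.4 p.22] -/
theorem actFn_theta_eq_iff (α β : G) :
    (TateTowerTheta.action φ).actFn α TateTowerTheta.theta = (TateTowerTheta.action φ).actFn β TateTowerTheta.theta ↔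
      φ α = φ β := by
  constructor
  · intro h
    have h' : (TateTowerTheta.action φ).actFn (β⁻¹ * α) TateTowerTheta.theta = TateTowerTheta.theta := by
      rw [map_mul, MulAut.mul_apply, h, ← MulAut.mul_apply, ← map_mul, inv_mul_cancel, map_one, MulAut.one_apply]
    have h1 := (actFn_theta_eq_theta_iff φ _).1 h'
    rwa [map_mul, map_inv, inv_mul_eq_one, eq_comm] at h1
  · intro h
    change baseAction.actFn (φ α) TateTowerTheta.theta = baseAction.actFn (φ β) TateTowerTheta.theta
    rw [h]

/-- The theta monoid `Ψ_{F^Θ,α} = O^× · (Θ̈^α)^ℕ` of the instance contains `Θ̈^α` and the base monoid does not: the two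
monoids of Example 3.2 (i)/(ii) are DISTINCT at the skeleton. [claim: Mochizuki2012, status: disputed]
(IUTchII §3 Ex 3.2, kurims pp.88–89) [cite: MochizukiEtTh2009, Prop 1.4 p.21] -/
theorem frobThetaMonoid_ne_baseMonoid (α : G) :
    (⟨CommGrpCat.of (Multiplicative Exp), (TateTowerTheta.action φ).actFn, divHom.ker, TateTowerTheta.theta,
        intConstants⟩ : TemperedFrobenioidThetaData.{0, 0} G).frobThetaMonoid α ≠ intConstants := by
  intro h
  have hmem : (TateTowerTheta.action φ).actFn α TateTowerTheta.theta ∈ intConstants := by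
    rw [← h]
    exact Submonoid.mem_sup_right (Submonoid.mem_powers _)
  have ht : eT (toAdd ((TateTowerTheta.action φ).actFn α TateTowerTheta.theta)) = 0 := hmem.2.2
  -- the `Θ̈`-exponent is untouched by the shear ([EtTh] Prop. 1.4 (ii)): `eT (Θ̈^α) = eT Θ̈ = 1`
  have e : eT (toAdd ((TateTowerTheta.action φ).actFn α TateTowerTheta.theta)) = eT (toAdd TateTowerTheta.theta) :=
    eT_shear _ _
  rw [e] at ht
  exact one_ne_zero ht

end TemperedThetaMonoids

end Literature.IUT.HodgeArakelov
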